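import Mathlib
import HarnessLib
import Summits.ValiantsHypothesis.ValiantsHypothesis.Theses.MonotoneRestoration
import Literature.Computability.AlgebraicComplexity.ArithCircuit
import Literature.Computability.AlgebraicComplexity.ArithCircuitProofs
import Literature.Computability.AlgebraicComplexity.MonotoneStructure
import Literature.Computability.AlgebraicComplexity.PermanentIrreducible
import Literature.ModelTheory.FiniteModelTheory.CkEquiv
import Summits.ValiantsHypothesis.ValiantsHypothesis.Theorems.MonotoneRestorationMonotoneRestorationQPCosetCount
import Summits.ValiantsHypothesis.ValiantsHypothesis.Theorems.MonotoneRestorationMonotoneRestorationQPSymmetricLB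
import Summits.ValiantsHypothesis.ValiantsHypothesis.Theorems.MonotoneRestorationMonotoneRestorationQPSupportSymmetrisation
import Summits.ValiantsHypothesis.ValiantsHypothesis.Theorems.MonotoneRestorationMonotoneRestorationQPSparseRegime
import Summits.ValiantsHypothesis.ValiantsHypothesis.Theorems.MonotoneRestorationMonotoneRestorationQPBeta
import Literature.Computability.AlgebraicComplexity.SymmetricArithCircuit
import Literature.Computability.AlgebraicComplexity.DawarWilsenach2025Proofs
import Literature.GroupTheory.PermutationGroups.SmallIndexSubgroups
import Summits.ValiantsHypothesis.ValiantsHypothesis.Theorems.MonotoneRestorationQP.Negative.LoadBearing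
import Summits.ValiantsHypothesis.ValiantsHypothesis.Theorems.MonotoneRestorationMonotoneRestorationQPPermSupportCount
import Summits.ValiantsHypothesis.ValiantsHypothesis.Theorems.MonotoneRestorationMonotoneRestorationQPGateSupport

/-! TTRL-lite variant V14318 of stmt-ValiantsHypothesis-15886

Variant `bound_nat:k≤6` of `stub_gateSupport` (line c2 of crux `MonotoneRestorationQP`): the
gate-stabiliser support theorem with the extra hypothesis `k ≤ 6`. It is an immediate
specialisation of the unrestricted, already landed support theorem `stub_gateSupport`
(`…QPGateSupport.lean`: the permutations admitting an extension fixing `g` form a subgroup `S` of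
`Sym_n`, left cosets of `S` inject into the gates so `[Sym_n : S] ≤ |G| < C(n,k)`, then
Dixon–Mortimer 5.2B via `alternating_fixing_le_of_index_lt_choose`); the bound `k ≤ 6` is not
needed.
-/

-- `Summit.ValiantsHypothesis.ValiantsHypothesis.…` is the tree's mandated single-conjunct layout
-- (Sub = Summit), so the duplicated namespace component is intended.
set_option linter.dupNamespace false

namespace Summit.ValiantsHypothesis.ValiantsHypothesis.Theorems

open Summit.ValiantsHypothesis.ValiantsHypothesis.Theses.MonotoneRestoration
open Literature.Computability.AlgebraicComplexity

/-- **TTRL-lite variant V14318 (`k ≤ 6`) of `stub_gateSupport`** (support theorem, gate-stabiliser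
form). In a `Sym_n`-symmetric labelled circuit with fewer than `C(n,k)` gates (`n > 8`, `1 ≤ k ≤ 6`,
`4k ≤ n`), every gate `g` admits a set `X` of fewer than `k` indices such that every EVEN
permutation fixing `X` pointwise extends to an automorphism fixing `g`. Immediate from the
unrestricted statement `stub_gateSupport`; the hypothesis `k ≤ 6` is discarded.
[cite: DawarWilsenach2025, §6 (support theorem); DixonMortimer1996, Thm 5.2B] -/
theorem stub_gateSupport_var14318 :
    ∀ (n : ℕ) (K : Type) (G : Type) [Fintype G] (C : LabelledArithCircuit K (Fin n × Fin n) Unit G)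
      (hC : C.IsSymmetric (Equiv.Perm (Fin n))) (k : ℕ) (hn : 8 < n) (hk : 1 ≤ k) (h4k : 4 * k ≤ n)
      (hcard : Fintype.card G < n.choose k) (g : G), k ≤ 6 → ∃ X : Finset (Fin n), X.card < k ∧
        ∀ ρ : Equiv.Perm (Fin n), (∀ x ∈ X, ρ x = x) → Equiv.Perm.sign ρ = 1 →
          ∃ π : Equiv.Perm G, C.IsAutomorphismExtending ρ π ∧ π g = g :=
  fun _ _ _ _ C hC _ hn hk h4k hcard g _ =>
    stub_gateSupport C hC hn hk h4k hcard g

end Summit.ValiantsHypothesis.ValiantsHypothesis.Theorems
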